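import Mathlib
import Summits.Ventures.HodgeRepro2.T5CMDecomposition
import Summits.Ventures.HodgeRepro2.T5CyclotomicSubfieldInertiaDeg

/-!
# COMPLEX CONJUGATION OF `ℚ(ζₘ)` IS `−1 ∈ (ℤ/mℤ)ˣ`, AND IT RESTRICTS TO THE CONJUGATION OF EVERY CM SUBFIELD

Tier-5 support N2 / N3 / §G-N4.2 (seat p3, gen 81). Two facts needed to read the inert/split census of an ARBITRARY CM
subfield `F ⊆ ℚ(ζₘ)` (any degree) off `(ℤ/mℤ)ˣ / H_F` (file 293):

* **`complexConj_zeta`**: Mathlib's complex conjugation of the CM field `ℚ(ζₘ)` (`2 < m`) sends `ζₘ ↦ ζₘ⁻¹` — for any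
  complex embedding `φ`, `φ (c ζ) = conj (φ ζ) = (φ ζ)⁻¹` since `|φ ζ| = 1`; **`galEquivZMod_conjGal`**: under
  `galEquivZMod` the conjugation `c = conjGal ℚ(ζₘ)` (p7's `conjGal`, `= complexConj` with `ℚ`-scalars) is `−1`;
* **`restrictNormal_conjGal`**: for a CM subfield `F` (Galois over `ℚ`) of ANY CM number field `L`, the restriction of
  `conjGal L` to `F` is `conjGal F` — both are the conjugation of the embedding `φ ∘ ι_F`;
  `restrictNormalHom_conjGal`: `conjGal F` is the image of `conjGal L` under `restrictNormalHom F`.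

§8(d): uses an L-value-free non-vanishing device: NO.
-/

open NumberField NumberField.IsCMField IsCyclotomicExtension.Rat ComplexEmbedding
open Summit.Ventures.HodgeRepro2.T5CMTypeGaloisDialect
open scoped ComplexConjugate

namespace Summit.Ventures.HodgeRepro2.T5CyclotomicConjugation

section Cyclotomic

variable (m : ℕ) [NeZero m] (L : Type*) [Field L] [NumberField L] [IsCyclotomicExtension {m} ℚ L]

omit [NeZero m] in
include m in
/-- `ℚ(ζₘ)` is a CM field for `2 < m` (Mathlib's `IsCyclotomicExtension.Rat.isCMField`). -/
theorem isCMField_of_two_lt (hm : 2 < m) : IsCMField L :=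
  IsCyclotomicExtension.Rat.isCMField (S := {m}) L ⟨m, Set.mem_singleton m, hm⟩

variable [IsCMField L]

/-- **Complex conjugation of `ℚ(ζₘ)` sends `ζₘ` to `ζₘ⁻¹`**: `φ (c ζ) = conj (φ ζ) = (φ ζ)⁻¹ = φ ζ⁻¹` for any complex
embedding `φ`, `|φ ζ| = 1` because `φ ζ` is a root of unity. -/
theorem complexConj_zeta :
    complexConj L (IsCyclotomicExtension.zeta m ℚ L) = (IsCyclotomicExtension.zeta m ℚ L)⁻¹ := by
  have hζ := IsCyclotomicExtension.zeta_spec m ℚ L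
  obtain ⟨φ⟩ : Nonempty (L →+* ℂ) := inferInstance
  apply φ.injective
  rw [complexEmbedding_complexConj, map_inv₀, Complex.inv_eq_conj]
  exact Complex.norm_eq_one_of_pow_eq_one (by rw [← map_pow, hζ.pow_eq_one, map_one]) (NeZero.ne m)

/-- `conjGal ℚ(ζₘ)` sends `ζₘ` to `ζₘ⁻¹`. -/
theorem conjGal_zeta :
    conjGal L (IsCyclotomicExtension.zeta m ℚ L) = (IsCyclotomicExtension.zeta m ℚ L)⁻¹ := by
  rw [conjGal_apply, complexConj_zeta]

/-- **COMPLEX CONJUGATION OF `ℚ(ζₘ)` IS `−1 ∈ (ℤ/mℤ)ˣ`** under Mathlib's `galEquivZMod`. -/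
theorem galEquivZMod_conjGal : galEquivZMod m L (conjGal L) = -1 := by
  have hζ := IsCyclotomicExtension.zeta_spec m ℚ L
  set ζ := IsCyclotomicExtension.zeta m ℚ L with hζdef
  set a : (ZMod m)ˣ := galEquivZMod m L (conjGal L) with ha
  have h1 : conjGal L ζ = ζ ^ (a : ZMod m).val := galEquivZMod_apply_of_pow_eq m L _ hζ.pow_eq_one
  rw [conjGal_zeta] at h1
  have h2 : ζ ^ ((a : ZMod m).val + 1) = 1 := by
    rw [pow_succ, ← h1, inv_mul_cancel₀ (hζ.ne_zero (NeZero.ne m))]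
  have h3 : m ∣ (a : ZMod m).val + 1 := hζ.dvd_of_pow_eq_one _ h2
  have h4 : (((a : ZMod m).val + 1 : ℕ) : ZMod m) = 0 := (ZMod.natCast_eq_zero_iff _ _).mpr h3
  apply Units.ext
  rw [Units.val_neg, Units.val_one]
  push_cast at h4
  rw [ZMod.natCast_zmod_val] at h4
  exact eq_neg_of_add_eq_zero_left h4

/-- `conjGal ℚ(ζₘ) = galEquivZMod⁻¹ (−1)`. -/
theorem conjGal_eq_symm_neg_one : conjGal L = (galEquivZMod m L).symm (-1) := by
  rw [← galEquivZMod_conjGal m L, MulEquiv.symm_apply_apply]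

end Cyclotomic

section Subfield

variable (L : Type*) [Field L] [NumberField L] [IsCMField L] (F : IntermediateField ℚ L) [IsCMField F]

/-- **The conjugation of a CM number field `L` restricts to the conjugation of a CM subfield `F`**: both are the
conjugation of the complex embedding `φ ∘ ι_F` (Mathlib's `complexEmbedding_complexConj` on `F` and on `L`). -/
theorem restrictNormal_conjGal [Normal ℚ F] : (conjGal L).restrictNormal F = conjGal F := by
  ext x
  obtain ⟨φ⟩ : Nonempty (L →+* ℂ) := inferInstance
  show algebraMap F L ((conjGal L).restrictNormal F x) = algebraMap F L (conjGal F x)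
  apply φ.injective
  rw [AlgEquiv.restrictNormal_commutes, conjGal_apply, conjGal_apply, complexEmbedding_complexConj]
  have h := complexEmbedding_complexConj F (φ.comp (algebraMap F L)) x
  simp only [RingHom.comp_apply] at h
  exact h.symm

/-- `conjGal F = restrictNormalHom F (conjGal L)`. -/
theorem restrictNormalHom_conjGal [Normal ℚ F] :
    AlgEquiv.restrictNormalHom F (conjGal L) = conjGal F :=
  restrictNormal_conjGal L F

end Subfield

end Summit.Ventures.HodgeRepro2.T5CyclotomicConjugation
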